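import Literature.NumberTheory.PAdicHodge.TatePairingPointOfKTwoMatching
import Literature.NumberTheory.PAdicHodge.KummerCocycleMatchingO
import Literature.NumberTheory.EllipticCurves.LocalTatePairingKummerTadic
import Literature.NumberTheory.PAdicHodge.TatePairingPointOfKTwoCanonical
import HarnessLib

/-!
# Kato's reciprocity law modulo (K₂) for a curve `W/K₀` ISOMORPHIC over `F = K_v` to a good `𝒪_D`-model: the TRANSPORT matching

Topic `Literature/NumberTheory/PAdicHodge`; THEOREMS ONLY (no definition, no named fact, no instance, no `sorry`). Brick G1 of memo
`Summits/BirchSwinnertonDyer/BirchSwinnertonDyer/Cruxes/StarredOptimalManinUnitFiveSeven/Lines/kato-lever-K3-legendre.md` §8 (crux K★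
`stmt-BirchSwinnertonDyer-22226`). The capstone `exists_const_tatePairingPoint_eq_neg_trace_of_KTwo_of_matching` (p744236) holds for ANY `W/K₀`
(`K₀ ⊆ F = K_v`) along an abstract equivariant matching `em : T_pW ≃ T_pŴ♭(𝒪_ℂ)`. Here `em` is built from a `Γ_F`-equivariant isomorphism of
geometric points `φ : (W ×_{K₀} F)(F̄) ≃ E(F̄)` onto the good `𝒪_D`-model `E = curveFO F W♭` (e.g. an admissible change of variables over `F`:
`VariableChange.pointEquivBaseChange`, `Affine.Point.congrEquiv`; the K★ cells: `W = W_min/ℚ`, `F = ℚ_p(ϖ)`, `E` the good model) and its Tate-module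
map `T_p(φ)` (`TateModule.mapEquivOfTorsion`, components `hTφ`):

  `em := θ_∞ ≫ T_p(φ) ≫ e`   (`θ_∞ = tateModuleEquiv W F p`, `e = AinfTop.tateGeomEquivTatePtOSS`),

and every bookkeeping hypothesis of the capstone is DISCHARGED: `hem` (§1), the `T`-adic Kummer cocycle `κ_Q` of `P ∈ W(F)`
(`LocalTatePairingKummerTadic`, p746770) is carried by `em` to K1's `κ_u` with `uₙ = z(φ Qₙ)` (§2, `tateGeomEquivTatePtOSS_kummer` on the division
sequence `φ ∘ Q` of `E`), and K1-O's pair `(bOmega + ι c_P, bEta + ι c'_P)` at a `Γ_F`-fixed lift of `z(φ Q₀)` integrates it (§2). Result (§3):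

* ★★★ `tatePairingPoint_eq_neg_trace_of_KTwo_transport` — ONE pair `(c_L ≠ 0, c)` such that for every `η ∈ Z¹(Γ_F, T_pW)`, every `P ∈ W(F)` with a
  division sequence `Q` whose image `φ Q₀` is a formal point of `E` with a `Γ_F`-fixed lift of its parameter, all `c_P, c'_P ∈ F`:
  **(K₂) for the explicit pair ⟹ `⟨[η], P⟩_W = −Tr_{F/ℚ_p}(c_P · exp*_d(η) · c)`** — the pairing, `exp*` and the representation are those of `W`
  itself (so the DESCENT `K_v → ℚ_p` of `EllipticCurves/ReciprocityLawDescent` applies when `W = W_min/ℚ`), the periods those of the good model.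
  The case `φ = id` (`W = E`) is `TatePairingPointOfKTwoCanonical`.

BSD / K★ / [REC] are NOT proved by this file; (K₂) is the research residue (memo §5/§7.3).

## References
* K. Kato, LNM 1553 (1993), Ch. II Thm. 1.4.1, Lemma 1.4.3. [Kato1993LNM1553]
* S. Bloch, K. Kato (1990), Ex. 3.10.1, Example 3.11. [BlochKato1990]
* J. H. Silverman, *AEC* (2009), III §1 and §7, Prop. VII.2.2, VIII §2, X §4 (isomorphic curves). [SilvermanAEC2009]
-/

noncomputable section

open Field Function ValuativeRel WittVector NumberField IsDedekindDomain
open scoped NumberField Topology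

namespace Literature.NumberTheory.PAdicHodge

open Literature.NumberTheory.GaloisRepresentations
open Literature.NumberTheory.GaloisRepresentations.IsNonarchimedeanLocalField
open Literature.NumberTheory.GaloisRepresentations.LubinTate
open Literature.NumberTheory.GaloisCohomology
open Literature.NumberTheory.EllipticCurves
open Literature.NumberTheory.EllipticCurves.FormalGroupChart
open Literature.NumberTheory.PAdicHodge.GaloisContinuity
open Literature.IUT.LogVolume
open _root_.WeierstrassCurve

section Helpers

variable {K₀ : Type} [Field K₀] (W : WeierstrassCurve K₀) {L : Type} [Field L] [Algebra K₀ L] {E' : WeierstrassCurve L}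
  (φ : geomPoints (W.baseChange L) ≃+ E'.geomPoints)
  (hφ : ∀ (σ : absoluteGaloisGroup L) (P : geomPoints (W.baseChange L)), φ (σ • P) = σ • φ P)
  {p : ℕ} [Fact p.Prime]
  (Tφ : (W.baseChange L).tateModule p ≃ₗ[ℤ_[p]] E'.tateModule p)
  (hTφ : ∀ (a : (W.baseChange L).tateModule p) (n : ℕ), TateModule.proj p n (Tφ a) = φ (TateModule.proj p n a))

include hφ hTφ in
/-- `T_p(φ)` is `Γ_L`-equivariant (componentwise `φ` is). [cite: SilvermanAEC2009, III §7] -/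
theorem tateMap_smul (σ : absoluteGaloisGroup L) (a : (W.baseChange L).tateModule p) : Tφ (σ • a) = σ • Tφ a :=
  TateModule.ext fun n => by
    rw [hTφ, TateModule.proj_smul_of_distribMulAction, TateModule.proj_smul_of_distribMulAction, hTφ, hφ]

omit [Fact p.Prime] in
/-- A division sequence of `W(L̄)` maps to a division sequence of `E'(L̄)`. [cite: SilvermanAEC2009, VIII §2] -/
theorem map_divSeq {Q : ℕ → geomPoints (W.baseChange L)} (hQ : ∀ n, p • Q (n + 1) = Q n) (n : ℕ) :
    p • (⇑φ ∘ Q) (n + 1) = (⇑φ ∘ Q) n := by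
  change p • φ (Q (n + 1)) = φ (Q n)
  rw [← map_nsmul, hQ]

omit [Fact p.Prime] in
include hφ in
/-- The image of a `Γ_L`-fixed base is `Γ_L`-fixed. [cite: SilvermanAEC2009, VIII §1] -/
theorem map_divSeq_fix {Q : ℕ → geomPoints (W.baseChange L)} (hfix : ∀ σ : absoluteGaloisGroup L, σ • Q 0 = Q 0)
    (σ : absoluteGaloisGroup L) : σ • (⇑φ ∘ Q) 0 = (⇑φ ∘ Q) 0 := by
  change σ • φ (Q 0) = φ (Q 0)
  rw [← hφ, hfix]

end Helpers

section Completion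

variable {K : Type} [Field K] [NumberField K] {p : ℕ} [hprime : Fact p.Prime] (v : HeightOneSpectrum (𝓞 K))
  [CharZero (v.adicCompletion K)] [LocallyCompactSpace (absoluteGaloisGroup (v.adicCompletion K))]
  [Fact (¬ IsUnit (p : integerC (v.adicCompletion K)))]
  [IsAdicComplete (Ideal.span {(p : integerC (v.adicCompletion K))}) (integerC (v.adicCompletion K))]
  [CharP 𝓀[v.adicCompletion K] p]
  {K₀ : Type} [Field K₀] [CharZero K₀] (W : WeierstrassCurve K₀) [W.IsElliptic] [Algebra K₀ (v.adicCompletion K)]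
  (hpv : valuation (v.adicCompletion K) (p : v.adicCompletion K) < 1)
  (Dv : EisensteinRoot (v.adicCompletion K) p hpv) (Wm : WeierstrassCurve (EisensteinRoot.CoeffDisc Dv))
  (ψm : EisensteinRoot.CoeffDisc Dv →+* LTCoeff (v.adicCompletion K))
  (hψm : ∀ c, algebraMap (LTCoeff (v.adicCompletion K)) (v.adicCompletion K) (ψm c) = EisensteinRoot.CoeffDisc.toF Dv c)
  (hp2 : p ≠ 2) (hΔ : IsUnit (Wm.map ψm).Δ) (hA : ((Wm.map ψm).map (AinfTop.redCoeff (v.adicCompletion K))).hasseCoeff p = 0)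
  [(curveOver (CompletedAlgClosure (v.adicCompletion K)) (Wm.map ψm)).IsElliptic]
  -- the isomorphism of geometric points onto the good model, and its Tate-module map
  (φ : geomPoints (W.baseChange (v.adicCompletion K)) ≃+ (AinfTop.curveFO (v.adicCompletion K) (Wm.map ψm)).geomPoints)
  (hφ : ∀ (σ : absoluteGaloisGroup (v.adicCompletion K)) (P : geomPoints (W.baseChange (v.adicCompletion K))), φ (σ • P) = σ • φ P)
  (Tφ : (W.baseChange (v.adicCompletion K)).tateModule p ≃ₗ[ℤ_[p]] (AinfTop.curveFO (v.adicCompletion K) (Wm.map ψm)).tateModule p)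
  (hTφ : ∀ (a : (W.baseChange (v.adicCompletion K)).tateModule p) (n : ℕ), TateModule.proj p n (Tφ a) = φ (TateModule.proj p n a))
  -- the Weil tower of `W`
  (e : (k : ℕ) → geomTorsion W ((p ^ k : ℕ) : ℤ) → geomTorsion W ((p ^ k : ℕ) : ℤ) → AlgebraicClosure K₀)
  (hμ : ∀ k S T, e k S T ^ (p ^ k) = 1) (hadd₁ : ∀ k S₁ S₂ T, e k (S₁ + S₂) T = e k S₁ T * e k S₂ T)
  (hadd₂ : ∀ k S T₁ T₂, e k S (T₁ + T₂) = e k S T₁ * e k S T₂)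
  (hgal : ∀ k (σ : absoluteGaloisGroup K₀) (S T : geomTorsion W ((p ^ k : ℕ) : ℤ)), σ • e k S T = e k (σ • S) (σ • T))
  (hcompat : ∀ k (S T : geomTorsion W ((p ^ (k + 1) : ℕ) : ℤ)),
    e k (torsionMulHom W (p ^ (k + 1)) (p ^ k) p (pow_succ p k).symm S)
      (torsionMulHom W (p ^ (k + 1)) (p ^ k) p (pow_succ p k).symm T) = e (k + 1) S T ^ p)

/-! ### §1 The transport matching and its equivariance -/

omit [LocallyCompactSpace (absoluteGaloisGroup (HeightOneSpectrum.adicCompletion K v))] [Fact (¬ IsUnit (p : integerC (v.adicCompletion K)))]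
  [IsAdicComplete (Ideal.span {(p : integerC (v.adicCompletion K))}) (integerC (v.adicCompletion K))]
  [(curveOver (CompletedAlgClosure (v.adicCompletion K)) (Wm.map ψm)).IsElliptic] in
include hφ hTφ in
/-- **Equivariance of the transport matching** `em = θ_∞ ≫ T_p(φ) ≫ e : T_pW|_{Γ_F} ⥲ T_pŴ♭(𝒪_ℂ)` along `absGaloisRestrict K₀ F`
(`tateModuleEquiv_smul`, `tateMap_smul`, `tateGeomEquivTatePtOSS_smul`). [cite: SilvermanAEC2009, III §7] -/
theorem em_transport_smul (σ : absoluteGaloisGroup (v.adicCompletion K)) (a : W.tateModule p) :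
    ((tateModuleEquiv W (v.adicCompletion K) p).trans (Tφ.trans (AinfTop.tateGeomEquivTatePtOSS (v.adicCompletion K) (Wm.map ψm) p hp2 hΔ hA))) (absGaloisRestrict K₀ (v.adicCompletion K) σ • a) = σ • ((tateModuleEquiv W (v.adicCompletion K) p).trans (Tφ.trans (AinfTop.tateGeomEquivTatePtOSS (v.adicCompletion K) (Wm.map ψm) p hp2 hΔ hA))) a := by
  change AinfTop.tateGeomEquivTatePtOSS (v.adicCompletion K) (Wm.map ψm) p hp2 hΔ hA (Tφ (tateModuleEquiv W (v.adicCompletion K) p (absGaloisRestrict K₀ (v.adicCompletion K) σ • a))) =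
    σ • AinfTop.tateGeomEquivTatePtOSS (v.adicCompletion K) (Wm.map ψm) p hp2 hΔ hA (Tφ (tateModuleEquiv W (v.adicCompletion K) p a))
  rw [tateModuleEquiv_smul, tateMap_smul W φ hφ Tφ hTφ]
  exact AinfTop.tateGeomEquivTatePtOSS_smul (Wm.map ψm) hp2 hΔ hA σ _

/-! ### §2 `em` carries the `T`-adic Kummer cocycle of `W` to K1's `κ_u`; the K1 pair integrates it -/

omit [LocallyCompactSpace (absoluteGaloisGroup (HeightOneSpectrum.adicCompletion K v))] [Fact (¬ IsUnit (p : integerC (v.adicCompletion K)))]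
  [IsAdicComplete (Ideal.span {(p : integerC (v.adicCompletion K))}) (integerC (v.adicCompletion K))] in
include hφ hTφ in
/-- **`em` carries the `T`-adic Kummer cocycle `κ_Q` of `W` to K1's `κ_u`** with `uₙ = z(φ Qₙ)`. [cite: SilvermanAEC2009, Prop. VII.2.2 and VIII §2] -/
theorem em_transport_tadicKummer_eq_kummerCocycleO
    {Q : ℕ → geomPoints (W.baseChange (v.adicCompletion K))} (hQ : ∀ n, p • Q (n + 1) = Q n)
    (hfix : ∀ σ : absoluteGaloisGroup (v.adicCompletion K), σ • Q 0 = Q 0)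
    (hker : ∀ n, AinfTop.geomToCO (Wm.map ψm) ((⇑φ ∘ Q) n) ∈ kernel (NormedField.valuation (K := CompletedAlgClosure (v.adicCompletion K))) (curveOver (CompletedAlgClosure (v.adicCompletion K)) (Wm.map ψm)))
    (κ : contOneCocycles (restrictedTateRep W (v.adicCompletion K) p).toTopRep)
    (hκ : ∀ σ, κ.1 σ = (tateModuleEquiv W (v.adicCompletion K) p).symm
      (TateModule.mk (fun n => σ • Q n - Q n) (pow_smul_gal_sub_divSeq_eq_zero W (v.adicCompletion K) p hQ hfix σ)
        (smul_gal_sub_divSeq_succ W (v.adicCompletion K) p hQ σ)))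
    (τ : absoluteGaloisGroup (v.adicCompletion K)) :
    ((tateModuleEquiv W (v.adicCompletion K) p).trans (Tφ.trans (AinfTop.tateGeomEquivTatePtOSS (v.adicCompletion K) (Wm.map ψm) p hp2 hΔ hA))) (κ.1 τ) =
      AinfRamTop.kummerCocycleO Wm ψm hψm (fun n => zPt (AinfTop.geomToCO (Wm.map ψm) ((⇑φ ∘ Q) n)) (hker n))
        (AinfTop.mulPC_zPt_divSeqO Wm ψm hψm (Q := ⇑φ ∘ Q) (map_divSeq W φ hQ) hker)
        (AinfTop.galCBall_zPt_divSeqO_zero Wm ψm (Q := ⇑φ ∘ Q) (map_divSeq_fix W φ hφ hfix) hker) τ := by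
  rw [hκ, LinearEquiv.trans_apply, LinearEquiv.apply_symm_apply, LinearEquiv.trans_apply]
  have hT : Tφ (TateModule.mk (fun n => τ • Q n - Q n) (pow_smul_gal_sub_divSeq_eq_zero W (v.adicCompletion K) p hQ hfix τ)
        (smul_gal_sub_divSeq_succ W (v.adicCompletion K) p hQ τ)) =
      TateModule.mk (fun n => τ • (⇑φ ∘ Q) n - (⇑φ ∘ Q) n)
        (AinfTop.pow_smul_kummerO_eq_zero Wm ψm (Q := ⇑φ ∘ Q) (map_divSeq W φ hQ) (map_divSeq_fix W φ hφ hfix) τ)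
        (AinfTop.smul_kummerO_succ Wm ψm (Q := ⇑φ ∘ Q) (map_divSeq W φ hQ) τ) :=
    TateModule.ext fun n => by
      rw [hTφ, TateModule.proj_mk, TateModule.proj_mk, map_sub, hφ]
      rfl
  rw [hT]
  exact AinfTop.tateGeomEquivTatePtOSS_kummer Wm ψm hψm hp2 hΔ hA (Q := ⇑φ ∘ Q) (map_divSeq W φ hQ) (map_divSeq_fix W φ hφ hfix) hker τ

omit [LocallyCompactSpace (absoluteGaloisGroup (HeightOneSpectrum.adicCompletion K v))] in
include hφ hTφ in
/-- **K1's `b_ω` (at any `Γ_F`-fixed lift `Q̂` of `z(φ Q₀)`), shifted by `ι(c_P)`, integrates `∫ω ∘ em ∘ κ_Q`.**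
[cite: BlochKato1990, Ex. 3.10.1, (3.11.1)] [cite: Kato1993LNM1553, Ch. II Lemma 1.4.3] -/
theorem omegaPeriodHomO_em_transport_tadicKummer
    {Q : ℕ → geomPoints (W.baseChange (v.adicCompletion K))} (hQ : ∀ n, p • Q (n + 1) = Q n)
    (hfix : ∀ σ : absoluteGaloisGroup (v.adicCompletion K), σ • Q 0 = Q 0)
    (hker : ∀ n, AinfTop.geomToCO (Wm.map ψm) ((⇑φ ∘ Q) n) ∈ kernel (NormedField.valuation (K := CompletedAlgClosure (v.adicCompletion K))) (curveOver (CompletedAlgClosure (v.adicCompletion K)) (Wm.map ψm)))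
    (κ : contOneCocycles (restrictedTateRep W (v.adicCompletion K) p).toTopRep)
    (hκ : ∀ σ, κ.1 σ = (tateModuleEquiv W (v.adicCompletion K) p).symm
      (TateModule.mk (fun n => σ • Q n - Q n) (pow_smul_gal_sub_divSeq_eq_zero W (v.adicCompletion K) p hQ hfix σ)
        (smul_gal_sub_divSeq_succ W (v.adicCompletion K) p hQ σ)))
    {Qhat : Wm.Pt (AinfRamTop.nilTheta Dv (surjective_fontaineTheta_integerC hpv))}
    (hQhat : AinfRamTop.thetaPt Wm (surjective_fontaineTheta_integerC hpv) Qhat = ⟨zPt (AinfTop.geomToCO (Wm.map ψm) ((⇑φ ∘ Q) 0)) (hker 0)⟩)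
    (hQhatσ : ∀ σ : absoluteGaloisGroup (v.adicCompletion K), AinfRamTop.galPtN Wm (surjective_fontaineTheta_integerC hpv) σ Qhat = Qhat)
    (cP : (v.adicCompletion K)) (τ : absoluteGaloisGroup (v.adicCompletion K)) :
    let hF := surjective_fontaineTheta_integerC hpv
    let em : W.tateModule p ≃ₗ[ℤ_[p]] AinfTop.TatePtO (v.adicCompletion K) (Wm.map ψm) p := ((tateModuleEquiv W (v.adicCompletion K) p).trans (Tφ.trans (AinfTop.tateGeomEquivTatePtOSS (v.adicCompletion K) (Wm.map ψm) p hp2 hΔ hA)))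
    let Pω : W.tateModule p →+ BdRPlusTop (v.adicCompletion K) p := (AinfRamTop.omegaPeriodHomO Wm ψm hF hψm).comp em.toAddMonoidHom
    Pω (κ.1 τ) =
      BdRPlusTop.gal (v.adicCompletion K) p τ (AinfRamTop.bOmega Wm (u := fun n => zPt (AinfTop.geomToCO (Wm.map ψm) ((⇑φ ∘ Q) n)) (hker n))
          (AinfTop.mulPC_zPt_divSeqO Wm ψm hψm (Q := ⇑φ ∘ Q) (map_divSeq W φ hQ) hker) hQhat + BdRPlusTop.of (v.adicCompletion K) p (embBdRHom hpv hF cP)) -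
        (AinfRamTop.bOmega Wm (u := fun n => zPt (AinfTop.geomToCO (Wm.map ψm) ((⇑φ ∘ Q) n)) (hker n))
          (AinfTop.mulPC_zPt_divSeqO Wm ψm hψm (Q := ⇑φ ∘ Q) (map_divSeq W φ hQ) hker) hQhat + BdRPlusTop.of (v.adicCompletion K) p (embBdRHom hpv hF cP)) := by
  intro hF em Pω
  change AinfRamTop.omegaPeriodHomO Wm ψm hF hψm (em (κ.1 τ)) = _
  rw [em_transport_tadicKummer_eq_kummerCocycleO v W hpv Dv Wm ψm hψm hp2 hΔ hA φ hφ Tφ hTφ hQ hfix hker κ hκ τ, map_add, BdRPlusTop.gal_of,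
    galBdRPlus_embBdRHom, add_sub_add_right_eq_sub]
  exact (AinfRamTop.gal_bOmega_sub_bOmega_eq_omegaPeriodHomO Wm ψm _ hQhat hQhatσ τ).symm

omit [LocallyCompactSpace (absoluteGaloisGroup (HeightOneSpectrum.adicCompletion K v))] in
include hφ hTφ in
/-- **K1's `b_η`, shifted by `ι(c'_P)`, integrates `∫η ∘ em ∘ κ_Q`.** [cite: BlochKato1990, Ex. 3.10.1, (3.11.1)] [cite: Kato1993LNM1553, Ch. II Lemma 1.4.3] -/
theorem etaPeriodHomO_em_transport_tadicKummer
    {Q : ℕ → geomPoints (W.baseChange (v.adicCompletion K))} (hQ : ∀ n, p • Q (n + 1) = Q n)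
    (hfix : ∀ σ : absoluteGaloisGroup (v.adicCompletion K), σ • Q 0 = Q 0)
    (hker : ∀ n, AinfTop.geomToCO (Wm.map ψm) ((⇑φ ∘ Q) n) ∈ kernel (NormedField.valuation (K := CompletedAlgClosure (v.adicCompletion K))) (curveOver (CompletedAlgClosure (v.adicCompletion K)) (Wm.map ψm)))
    (κ : contOneCocycles (restrictedTateRep W (v.adicCompletion K) p).toTopRep)
    (hκ : ∀ σ, κ.1 σ = (tateModuleEquiv W (v.adicCompletion K) p).symm
      (TateModule.mk (fun n => σ • Q n - Q n) (pow_smul_gal_sub_divSeq_eq_zero W (v.adicCompletion K) p hQ hfix σ)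
        (smul_gal_sub_divSeq_succ W (v.adicCompletion K) p hQ σ)))
    {Qhat : Wm.Pt (AinfRamTop.nilTheta Dv (surjective_fontaineTheta_integerC hpv))}
    (hQhat : AinfRamTop.thetaPt Wm (surjective_fontaineTheta_integerC hpv) Qhat = ⟨zPt (AinfTop.geomToCO (Wm.map ψm) ((⇑φ ∘ Q) 0)) (hker 0)⟩)
    (hQhatσ : ∀ σ : absoluteGaloisGroup (v.adicCompletion K), AinfRamTop.galPtN Wm (surjective_fontaineTheta_integerC hpv) σ Qhat = Qhat)
    (cP' : (v.adicCompletion K)) (τ : absoluteGaloisGroup (v.adicCompletion K)) :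
    let hF := surjective_fontaineTheta_integerC hpv
    let em : W.tateModule p ≃ₗ[ℤ_[p]] AinfTop.TatePtO (v.adicCompletion K) (Wm.map ψm) p := ((tateModuleEquiv W (v.adicCompletion K) p).trans (Tφ.trans (AinfTop.tateGeomEquivTatePtOSS (v.adicCompletion K) (Wm.map ψm) p hp2 hΔ hA)))
    let Pη : W.tateModule p →+ BdRPlusTop (v.adicCompletion K) p := (AinfRamTop.etaPeriodHomO Wm ψm hF hψm).comp em.toAddMonoidHom
    Pη (κ.1 τ) =
      BdRPlusTop.gal (v.adicCompletion K) p τ (AinfRamTop.bEta Wm (u := fun n => zPt (AinfTop.geomToCO (Wm.map ψm) ((⇑φ ∘ Q) n)) (hker n))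
          (AinfTop.mulPC_zPt_divSeqO Wm ψm hψm (Q := ⇑φ ∘ Q) (map_divSeq W φ hQ) hker) hQhat + BdRPlusTop.of (v.adicCompletion K) p (embBdRHom hpv hF cP')) -
        (AinfRamTop.bEta Wm (u := fun n => zPt (AinfTop.geomToCO (Wm.map ψm) ((⇑φ ∘ Q) n)) (hker n))
          (AinfTop.mulPC_zPt_divSeqO Wm ψm hψm (Q := ⇑φ ∘ Q) (map_divSeq W φ hQ) hker) hQhat + BdRPlusTop.of (v.adicCompletion K) p (embBdRHom hpv hF cP')) := by
  intro hF em Pη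
  change AinfRamTop.etaPeriodHomO Wm ψm hF hψm (em (κ.1 τ)) = _
  rw [em_transport_tadicKummer_eq_kummerCocycleO v W hpv Dv Wm ψm hψm hp2 hΔ hA φ hφ Tφ hTφ hQ hfix hker κ hκ τ, map_add, BdRPlusTop.gal_of,
    galBdRPlus_embBdRHom, add_sub_add_right_eq_sub]
  exact (AinfRamTop.gal_bEta_sub_bEta_eq_etaPeriodHomO Wm ψm _ hQhat hQhatσ τ).symm

/-! ### §3 Kato's formula for `W` at a point mapping to a formal point of the good model, modulo (K₂) -/

set_option maxHeartbeats 800000 in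
include hφ hTφ in
/-- ★★★ **Kato's reciprocity law at `(η, P)` for `W/K₀` at `F = K_v`, GRANTED ONLY (K₂), along the transport matching.** ONE pair
`(c_L ≠ 0, c)` such that for every cocycle `η` of `T_pW|_{Γ_F}`, every `P ∈ W(F)` with a `p`-power division sequence `Q` whose image `φ Q₀` is a
formal point of `E` (`∈ E₁(ℂ_F)`) admitting a `Γ_F`-fixed lift `Q̂ ∈ Ŵ(𝔫_𝒪)` of its parameter, and all `c_P, c'_P ∈ F`:
**(K₂) for the explicit pair `(bOmega + ι c_P, bEta + ι c'_P)` ⟹ `⟨[η], P⟩_W = −Tr_{F/ℚ_p}(c_P · exp*_d(η) · c)`** — pairing, `exp*`, `d` and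
representation are those of `W`; the periods `∫ω, ∫η` are K1-O's on the good model, read on `T_pW` through `em`.
[cite: Kato1993LNM1553, Ch. II Thm. 1.4.1 (3)–(4) and Lemma 1.4.3] [cite: BlochKato1990, Ex. 3.10.1, Example 3.11] [cite: SilvermanAEC2009, X §4] -/
theorem tatePairingPoint_eq_neg_trace_of_KTwo_transport
    (hN1 : ∃ τ, AinfRamTop.omegaPeriodHomO Wm ψm (surjective_fontaineTheta_integerC hpv) hψm τ ≠ 0)
    (hNη : ∃ τ, AinfRamTop.etaPeriodHomO Wm ψm (surjective_fontaineTheta_integerC hpv) hψm τ ∉ (BdRPlusTop.filOne (v.adicCompletion K) p).toIdeal)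
    (ψ : C(absoluteGaloisGroup (v.adicCompletion K), ℤ_[p])) (hψ : ∀ σ τ, ψ (σ * τ) = ψ σ + ψ τ)
    (hψlog : ∀ τ, (ψ τ : ℚ_[p]) = logCyclotomic (F := (v.adicCompletion K)) p τ)
    (heL : ∀ (c : ℤ_[p]) (S U : W.tateModule p), (weilContPairingPadic W (v.adicCompletion K) p e hμ hadd₁ hadd₂ hgal hcompat).toLin (c • S) U =
      twistHom (v.adicCompletion K) p ((weilContPairingPadic W (v.adicCompletion K) p e hμ hadd₁ hadd₂ hgal hcompat).toLin S U) c)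
    (healt : ∀ S : W.tateModule p, (weilContPairingPadic W (v.adicCompletion K) p e hμ hadd₁ hadd₂ hgal hcompat).toLin S S = 0)
    (henondeg : ∀ S : W.tateModule p,
      (∀ U, (weilContPairingPadic W (v.adicCompletion K) p e hμ hadd₁ hadd₂ hgal hcompat).toLin S U = 0) → S = 0)
    (hinj : letI := LocalField.padicAlgebra (v.adicCompletion K) p hpv
      (bdRPeriodRingData (F := (v.adicCompletion K)) (p := p) hpv).CupLogInjective (logCyclotomic p) (restrictedRationalTateRep W (v.adicCompletion K) p))
    (hde : letI := LocalField.padicAlgebra (v.adicCompletion K) p hpv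
      ∀ η : contOneCocycles (restrictedTateRep W (v.adicCompletion K) p).toTopRep,
        (bdRPeriodRingData (F := (v.adicCompletion K)) (p := p) hpv).HasDualExp (logCyclotomic p) (restrictedRationalTateRep W (v.adicCompletion K) p)
          fun σ => TateModule.toRational p (η.1 σ))
    (d : letI := LocalField.padicAlgebra (v.adicCompletion K) p hpv
      (bdRPeriodRingData (F := (v.adicCompletion K)) (p := p) hpv).FilZeroLine (restrictedRationalTateRep W (v.adicCompletion K) p)) :
    letI := LocalField.padicAlgebra (v.adicCompletion K) p hpv
    let hF := surjective_fontaineTheta_integerC hpv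
    let em : W.tateModule p ≃ₗ[ℤ_[p]] AinfTop.TatePtO (v.adicCompletion K) (Wm.map ψm) p := ((tateModuleEquiv W (v.adicCompletion K) p).trans (Tφ.trans (AinfTop.tateGeomEquivTatePtOSS (v.adicCompletion K) (Wm.map ψm) p hp2 hΔ hA)))
    let Pω : W.tateModule p →+ BdRPlusTop (v.adicCompletion K) p := (AinfRamTop.omegaPeriodHomO Wm ψm hF hψm).comp em.toAddMonoidHom
    let Pη : W.tateModule p →+ BdRPlusTop (v.adicCompletion K) p := (AinfRamTop.etaPeriodHomO Wm ψm hF hψm).comp em.toAddMonoidHom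
    ∃ (cL c : (v.adicCompletion K)), cL ≠ 0 ∧
      (∀ S U : W.tateModule p, Pω S * Pη U - Pη S * Pω U = BdRPlusTop.of (v.adicCompletion K) p (embBdRHom hpv hF cL) *
        BdRPlusTop.periodLine (v.adicCompletion K) p ((weilContPairingPadic W (v.adicCompletion K) p e hμ hadd₁ hadd₂ hgal hcompat).toLin S U)) ∧
      ∀ (η : contOneCocycles (restrictedTateRep W (v.adicCompletion K) p).toTopRep) (P : (W.baseChange (v.adicCompletion K)).toAffine.Point)
        (Q : ℕ → geomPoints (W.baseChange (v.adicCompletion K))) (hQ : ∀ n, p • Q (n + 1) = Q n) (hQ0 : Q 0 = toGeomPoints (W.baseChange (v.adicCompletion K)) P)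
        (hP1 : AinfTop.geomToCO (Wm.map ψm) ((⇑φ ∘ Q) 0) ∈ kernel (NormedField.valuation (K := CompletedAlgClosure (v.adicCompletion K))) (curveOver (CompletedAlgClosure (v.adicCompletion K)) (Wm.map ψm)))
        (Qhat : Wm.Pt (AinfRamTop.nilTheta Dv hF))
        (hQhat : AinfRamTop.thetaPt Wm hF Qhat =
          ⟨zPt (AinfTop.geomToCO (Wm.map ψm) ((⇑φ ∘ Q) 0)) (AinfTop.geomToCO_divSeq_mem_kernel (Wm.map ψm) hp2 hΔ hA (Q := ⇑φ ∘ Q) (map_divSeq W φ hQ) hP1 0)⟩)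
        (hQhatσ : ∀ σ : absoluteGaloisGroup (v.adicCompletion K), AinfRamTop.galPtN Wm hF σ Qhat = Qhat) (cP cP' : (v.adicCompletion K)) (N : ℕ),
        let bω : BdRPlusTop (v.adicCompletion K) p := AinfRamTop.bOmega Wm (u := fun n => zPt (AinfTop.geomToCO (Wm.map ψm) ((⇑φ ∘ Q) n)) (AinfTop.geomToCO_divSeq_mem_kernel (Wm.map ψm) hp2 hΔ hA (Q := ⇑φ ∘ Q) (map_divSeq W φ hQ) hP1 n))
          (AinfTop.mulPC_zPt_divSeqO Wm ψm hψm (Q := ⇑φ ∘ Q) (map_divSeq W φ hQ) (AinfTop.geomToCO_divSeq_mem_kernel (Wm.map ψm) hp2 hΔ hA (Q := ⇑φ ∘ Q) (map_divSeq W φ hQ) hP1)) hQhat + BdRPlusTop.of (v.adicCompletion K) p (embBdRHom hpv hF cP)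
        let bη : BdRPlusTop (v.adicCompletion K) p := AinfRamTop.bEta Wm (u := fun n => zPt (AinfTop.geomToCO (Wm.map ψm) ((⇑φ ∘ Q) n)) (AinfTop.geomToCO_divSeq_mem_kernel (Wm.map ψm) hp2 hΔ hA (Q := ⇑φ ∘ Q) (map_divSeq W φ hQ) hP1 n))
          (AinfTop.mulPC_zPt_divSeqO Wm ψm hψm (Q := ⇑φ ∘ Q) (map_divSeq W φ hQ) (AinfTop.geomToCO_divSeq_mem_kernel (Wm.map ψm) hp2 hΔ hA (Q := ⇑φ ∘ Q) (map_divSeq W φ hQ) hP1)) hQhat + BdRPlusTop.of (v.adicCompletion K) p (embBdRHom hpv hF cP')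
        (∀ σ, IsTeichLog 2 ((BdRPlusTop.of (v.adicCompletion K) p).symm ((p : BdRPlusTop (v.adicCompletion K) p) ^ N *
          (BdRPlusTop.of (v.adicCompletion K) p (embBdRHom hpv hF cL⁻¹) * Pη (η.1 σ) * bω -
            Pω (η.1 σ) * (BdRPlusTop.of (v.adicCompletion K) p (embBdRHom hpv hF cL⁻¹) * bη))))) →
        (∀ M' : ℕ, ∀ᶠ σ in 𝓝 (1 : absoluteGaloisGroup (v.adicCompletion K)), ∃ L' : BDeRhamPlus (integerC (v.adicCompletion K)) p, IsTeichLog 2 L' ∧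
          (BdRPlusTop.of (v.adicCompletion K) p).symm ((p : BdRPlusTop (v.adicCompletion K) p) ^ N *
            (BdRPlusTop.of (v.adicCompletion K) p (embBdRHom hpv hF cL⁻¹) * Pη (η.1 σ) * bω -
              Pω (η.1 σ) * (BdRPlusTop.of (v.adicCompletion K) p (embBdRHom hpv hF cL⁻¹) * bη))) -
            (p : BDeRhamPlus (integerC (v.adicCompletion K)) p) ^ M' * L' ∈ Ideal.span {(xiBdR : BDeRhamPlus (integerC (v.adicCompletion K)) p) ^ 2}) →
        ((tatePairingPoint W (v.adicCompletion K) p e hμ hadd₁ hadd₂ hgal hcompat (oneCocycleClass _ η) P : ℤ_[p]) : ℚ_[p]) =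
          -Algebra.trace ℚ_[p] (v.adicCompletion K) (cP * (expStarCoord W hpv d η * c)) := by
  intro hF em Pω Pη
  have hem : ∀ (σ : absoluteGaloisGroup (v.adicCompletion K)) (a : W.tateModule p), em (absGaloisRestrict K₀ (v.adicCompletion K) σ • a) = σ • em a :=
    em_transport_smul v W hpv Dv Wm ψm hp2 hΔ hA φ hφ Tφ hTφ
  have hPωapp : ∀ a, Pω a = AinfRamTop.omegaPeriodHomO Wm ψm hF hψm (em a) := fun _ => rfl
  have hPηapp : ∀ a, Pη a = AinfRamTop.etaPeriodHomO Wm ψm hF hψm (em a) := fun _ => rfl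
  have hPωZ : ∀ (c : ℤ_[p]) (a : W.tateModule p), Pω (c • a) = BdRPlusTop.of (v.adicCompletion K) p (qpToBdR (c : ℚ_[p])) * Pω a :=
    fun c a => by rw [hPωapp, hPωapp, map_smul, AinfRamTop.omegaPeriodHomO_smul']
  have hPηZ : ∀ (c : ℤ_[p]) (a : W.tateModule p), Pη (c • a) = BdRPlusTop.of (v.adicCompletion K) p (qpToBdR (c : ℚ_[p])) * Pη a :=
    fun c a => by rw [hPηapp, hPηapp, map_smul, AinfRamTop.etaPeriodHomO_smul']
  have hPω : ∀ (σ : absoluteGaloisGroup (v.adicCompletion K)) (a : W.tateModule p),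
      BdRPlusTop.gal (v.adicCompletion K) p σ (Pω a) = Pω (restrictedTateRep W (v.adicCompletion K) p σ a) := fun σ a => by
    rw [hPωapp, hPωapp, AinfRamTop.gal_omegaPeriodHomO, restrictedTateRep_apply_apply, hem]
  have hPη : ∀ (σ : absoluteGaloisGroup (v.adicCompletion K)) (a : W.tateModule p),
      BdRPlusTop.gal (v.adicCompletion K) p σ (Pη a) = Pη (restrictedTateRep W (v.adicCompletion K) p σ a) := fun σ a => by
    rw [hPηapp, hPηapp, AinfRamTop.gal_etaPeriodHomO, restrictedTateRep_apply_apply, hem]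
  have hfil : ∀ a, Pω a ∈ (BdRPlusTop.filOne (v.adicCompletion K) p).toIdeal := fun a => by
    rw [hPωapp]; exact AinfRamTop.omegaPeriodHomO_mem_filOne Wm ψm _
  have hne : ∃ a, Pω a ≠ 0 := by
    obtain ⟨τ, hτ⟩ := hN1
    exact ⟨em.symm τ, by rwa [hPωapp, LinearEquiv.apply_symm_apply]⟩
  have hnot : ∃ a, Pη a ∉ (BdRPlusTop.filOne (v.adicCompletion K) p).toIdeal := by
    obtain ⟨τ, hτ⟩ := hNη
    exact ⟨em.symm τ, by rwa [hPηapp, LinearEquiv.apply_symm_apply]⟩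
  obtain ⟨cL, c, hcL, hLeg, hmain⟩ := exists_const_tatePairingPoint_eq_neg_trace_of_KTwo v W e hμ hadd₁ hadd₂ hgal hcompat hpv hF
    ψ hψ hψlog hPωZ hPηZ hPω hPη hfil hne hnot heL healt henondeg hinj hde d
  refine ⟨cL, c, hcL, hLeg, ?_⟩
  intro η P Q hQ hQ0 hP1 Qhat hQhat hQhatσ cP cP' N bω bη hX hXs
  have hfix : ∀ σ : absoluteGaloisGroup (v.adicCompletion K), σ • Q 0 = Q 0 := gal_smul_divSeq_zero W (v.adicCompletion K) hQ0
  have hker := AinfTop.geomToCO_divSeq_mem_kernel (Wm.map ψm) hp2 hΔ hA (Q := ⇑φ ∘ Q) (map_divSeq W φ hQ) hP1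
  obtain ⟨κ, hκ⟩ := exists_contOneCocycles_tadicKummer W (v.adicCompletion K) p hQ hfix
  have h1 := cohomologyMap_tateProjMor_oneCocycleClass_eq_kummerLevelClass W (v.adicCompletion K) p hQ hQ0 κ hκ
  have h2 : ∀ τ, Pω (κ.1 τ) = BdRPlusTop.gal (v.adicCompletion K) p τ bω - bω :=
    omegaPeriodHomO_em_transport_tadicKummer v W hpv Dv Wm ψm hψm hp2 hΔ hA φ hφ Tφ hTφ hQ hfix hker κ hκ hQhat hQhatσ cP
  have h3 : ∀ τ, Pη (κ.1 τ) = BdRPlusTop.gal (v.adicCompletion K) p τ bη - bη :=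
    etaPeriodHomO_em_transport_tadicKummer v W hpv Dv Wm ψm hψm hp2 hΔ hA φ hφ Tφ hTφ hQ hfix hker κ hκ hQhat hQhatσ cP'
  have h4 : thetaBdR ((BdRPlusTop.of (v.adicCompletion K) p).symm bω) = algebraMap (v.adicCompletion K) (CompletedAlgClosure (v.adicCompletion K)) cP :=
    thetaBdR_bOmega_add_embBdRHom v hpv Dv Wm (u := fun n => zPt (AinfTop.geomToCO (Wm.map ψm) ((⇑φ ∘ Q) n)) (hker n))
      (AinfTop.mulPC_zPt_divSeqO Wm ψm hψm (Q := ⇑φ ∘ Q) (map_divSeq W φ hQ) hker) hQhat cP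
  exact hmain η κ P h1 bω bη cP h2 h3 h4 N hX hXs

end Completion

end Literature.NumberTheory.PAdicHodge

end
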